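import Summits.Ventures.PercRepro.RLSZeroSums

/-!
# C-025 at q = 3: P₂ at t = 0 under R₃⁺ — the count of the witnesses containing a fixed triple (night-3, gen 3)

`lostSum n = Σ_{j < n − 2} C(n + 1, j)` counts the witnesses `X ⊆ K` (`|K| = p = n + 4`, `1 ≤ |X| ≤ n`) that contain
a fixed `3`-subset of `K`: `C(p − 3, x − 3)` at level `x`.  Closed form `lostP n = 2^(n+1) − 1 − (n + 1) − C(n+1, 2) −
C(n+1, 3)` (the four missing top levels by symmetry).  Used by `RLSZeroWorld3.lean` (`zero_l2a2`).
-/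

open PercRepro.NightThree.CF PercRepro.NightThree.U0

namespace PercRepro.NightThree.U0

open Finset

/-- `Σ_{j < n − 2} C(n + 1, j)`: the witnesses containing a fixed triple, all levels. -/
def lostSum (n : ℕ) : ℚ := ∑ j ∈ range (n - 2), ((n + 1).choose j : ℚ)

/-- Its closed form (a polynomial in `n` and `2^n`). -/
def lostP (n : ℕ) : ℚ :=
  2 * 2 ^ n - 1 - ((n : ℚ) + 1) - ((n : ℚ) + 1) * (n : ℚ) / 2 - ((n : ℚ) + 1) * (n : ℚ) * ((n : ℚ) - 1) / 6

/-- `C(k + 2, 2) = (k + 2)(k + 1)/2` in `ℚ`. -/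
theorem choose_two_cast_eq' (k : ℕ) : (((k + 2).choose 2 : ℕ) : ℚ) = ((k : ℚ) + 2) * ((k : ℚ) + 1) / 2 := by
  induction k with
  | zero => norm_num
  | succ j ih =>
    rw [show j + 1 + 2 = (j + 2) + 1 by omega, Nat.choose_succ_succ, Nat.cast_add, ih, Nat.choose_one_right]
    push_cast
    ring

/-- `C(k + 3, 3) = (k + 3)(k + 2)(k + 1)/6` in `ℚ`. -/
theorem choose_three_cast_eq' (k : ℕ) :
    (((k + 3).choose 3 : ℕ) : ℚ) = ((k : ℚ) + 3) * ((k : ℚ) + 2) * ((k : ℚ) + 1) / 6 := by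
  induction k with
  | zero => norm_num
  | succ j ih =>
    rw [show j + 1 + 3 = (j + 3) + 1 by omega, Nat.choose_succ_succ, Nat.cast_add, ih,
      show j + 3 = (j + 1) + 2 by omega, choose_two_cast_eq']
    push_cast
    ring

/-- `Σ_{j ≤ N} C(N, j) = 2^N` in `ℚ`. -/
theorem sum_range_choose_rat (N : ℕ) : ∑ j ∈ range (N + 1), (N.choose j : ℚ) = 2 ^ N := by
  exact_mod_cast Nat.sum_range_choose N

/-- `lostSum n = lostP n` for `n ≥ 2`. -/
theorem lost_eq_P (n : ℕ) (hn : 2 ≤ n) : lostSum n = lostP n := by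
  unfold lostSum lostP
  have hsplit := Finset.sum_range_add_sum_Ico (fun j => ((n + 1).choose j : ℚ)) (show n - 2 ≤ n + 1 + 1 by omega)
  rw [sum_range_choose_rat] at hsplit
  -- the top four levels `j = n − 2, …, n + 1` are `C(n+1, 3), C(n+1, 2), C(n+1, 1), C(n+1, 0)` by symmetry
  have htop : ∑ j ∈ Finset.Ico (n - 2) (n + 1 + 1), ((n + 1).choose j : ℚ) =
      ((n + 1).choose 3 : ℚ) + ((n + 1).choose 2 : ℚ) + ((n : ℚ) + 1) + 1 := by
    rw [Finset.sum_Ico_eq_sum_range, show n + 1 + 1 - (n - 2) = 4 by omega]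
    simp only [Finset.sum_range_succ, Finset.range_zero, Finset.sum_empty, zero_add]
    rw [show n - 2 + 0 = n + 1 - 3 by omega, show n - 2 + 1 = n + 1 - 2 by omega,
      show n - 2 + 2 = n + 1 - 1 by omega, show n - 2 + 3 = n + 1 - 0 by omega,
      Nat.choose_symm (by omega), Nat.choose_symm (by omega), Nat.choose_symm (by omega),
      Nat.choose_symm (by omega), Nat.choose_one_right, Nat.choose_zero_right]
    push_cast
    ring
  rw [htop] at hsplit
  rw [pow_succ] at hsplit
  have h2 : ((n + 1).choose 2 : ℚ) = ((n : ℚ) + 1) * (n : ℚ) / 2 := by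
    obtain ⟨k, rfl⟩ : ∃ k, n = k + 1 := ⟨n - 1, by omega⟩
    rw [show k + 1 + 1 = k + 2 by omega, choose_two_cast_eq']
    push_cast
    ring
  have h3 : ((n + 1).choose 3 : ℚ) = ((n : ℚ) + 1) * (n : ℚ) * ((n : ℚ) - 1) / 6 := by
    obtain ⟨k, rfl⟩ : ∃ k, n = k + 2 := ⟨n - 2, by omega⟩
    rw [show k + 2 + 1 = k + 3 by omega, choose_three_cast_eq']
    push_cast
    ring
  rw [h2, h3] at hsplit
  linarith

end PercRepro.NightThree.U0
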